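import Summits.ResolutionOfSingularities.ResolutionOfSingularities.Theorems.TeissierResolve.Negative.IsReducedLoadBearing
import Summits.ResolutionOfSingularities.ResolutionOfSingularities.Theorems.DescentAlgclosedToPerfect.Negative.AntecedentNonVacuity

/-!
# `TeissierResolve` — negative lemmas II: finiteness of `π` is load-bearing

Support (negative) lemmas for the crux `stmt-ResolutionOfSingularities-17086`
(`Summit.ResolutionOfSingularities.ResolutionOfSingularities.Theses.TeissierJung.TeissierResolve`,
route `TeissierJung`, rank 3), filed by the standing disprover (cdisprove gen 1, cycle 1; work file
`Cruxes/TeissierResolve/Disproof.lean`; companion of `Negative/IsReducedLoadBearing.lean`, which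
restates the crux as `∀ p k X', TeissierPresented k X' → Scheme.HasResolution X'`,
`teissierResolve_iff`). The file declares NO definition; the mutated crux is written out inline.

`TeissierPresented k X'` asks that `X'` be integral and FINITE (`IsFinite π`) over a regular
integral separated `k`-scheme `S` of finite type, and that at every closed point `x`, every
analytic branch `𝒪̂_{X',x} ⧸ P` (`P` a minimal prime of the `𝔪`-adic completion of the stalk)
carry a Teissier presentation over an isomorphism `𝒪̂_{S,π x} ≅ k⟦x₁, …, x_d⟧`.

## Findings (all sorry-free)

* `bijective_quotient_adicCompletion_of_idempotent` — if `I ⊆ I²` and `A = j(k) + I` for a ring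
  map `j` from a field, then every branch `Â ⧸ P` of the `I`-adic completion is `k` (all `Iⁿ = I`,
  so `Â = A ⧸ I`: the adic completion cannot see a ring with idempotent maximal ideal).
* `exists_sq_eq_of_isLocalization`, `mem_sq_maximalIdeal_of_forall_exists_sq` — square-root
  closedness localises, and makes the maximal ideal of a local ring idempotent.
* `absoluteIntegralClosure_exists_sub_mem`, `absoluteIntegralClosure_localization_exists_sub_mem`
  — for `k` algebraically closed, every maximal ideal `𝔪` of `k[X]⁺` (the integral closure of
  `k[X]` in an algebraic closure of `k(X)`) and of its localisations has residue field `k`: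
  `𝔪 ∩ k[X] = (X − c₀)` (`k[X]` is a PID, irreducibles are linear), and an element integral over
  `k[X]` is, modulo `𝔪`, integral over `k[X]/(X − c₀) = k`, hence a constant
  (`IsAlgClosed.ringHom_bijective_of_isIntegral`).
* `specAbsoluteIntegralClosure_teissierBranches` — THE WITNESS: `X' = Spec k[X]⁺ → S = Spec k`
  satisfies every conjunct of `TF` except `IsFinite π`: `X'` is integral, `S = Spec k` is a regular
  integral separated `k`-scheme of finite type, and at every closed point the stalk is square-root
  closed (`absoluteIntegralClosure_exists_sq_eq` of the tree), so its maximal ideal is idempotent,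
  its completion is `k`, the unique (minimal) prime of the completion is `0` and the branch
  `k = k⟦∅⟧` is Teissier-presented with `d = g = 0`, compatibly with `𝒪̂_{Spec k} = k` and the
  stalk map (naturality `stalkMap_stalkIso_inv_algebraMap` of the companion file).
* `teissierResolve_false_without_isFinite` (every prime `p`; the form with the crux's own prefix
  `∀ p prime …` follows at `p = 2`; the mutated hypothesis is visibly a weakening of
  `TeissierPresented`) — THE NEGATIVE LEMMA: with `IsFinite π` dropped the crux is FALSE, since
  `Spec 𝔽̄_p[X]⁺` has no resolution (tree:
  `Theorems/DescentAlgclosedToPerfect/Negative/AntecedentNonVacuity.lean`,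
  `not_hasResolution_spec_absoluteIntegralClosure`: every non-generic stalk is non-Noetherian,
  while a resolution makes the stalks over a dense open regular).

MORAL (for provers of the crux). The only Noetherianity — indeed the only finiteness — in `TF`
enters through `IsFinite π` and the finite type of `S`: the branch condition is a statement about
`𝒪̂_{X',x}`, and adic completion forgets everything below `⋂ 𝔪ⁿ`. Any proof must use Krull's
intersection theorem `𝒪_{X',x} ↪ 𝒪̂_{X',x}` (and, by the companion file, reducedness of
`𝒪̂_{X',x}`), i.e. genuinely pass through the finite map `π` to the excellent base `S`; the
Teissier data alone do not even imply that `X'` is locally Noetherian.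

## Sources
* M. Artin, *On the joins of Hensel rings*, Adv. Math. 7 (1971) 282–296 (absolute integral
  closure); root-closed local rings have idempotent maximal ideal (folklore).
* H. Matsumura, *Commutative Ring Theory*, CUP 1986, Thm. 8.10 (Krull's intersection theorem),
  §8 (adic completion). [Matsumura1986]
* H. Mourtada, B. Schober, *Teissier singularities*, C. R. Math. 363 (2025) = arXiv:2502.01239,
  §3. [MourtadaSchober2025]
* Tree: `Negative/IsReducedLoadBearing.lean` (bridge, naturality, `k ≅ k⟦∅⟧`),
  `Theorems/DescentAlgclosedToPerfect/Negative/AntecedentNonVacuity.lean` (`k[X]⁺` witness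
  lemmas), `Literature/AlgebraicGeometry/Resolution/TeissierPresentation.lean`.
-/

noncomputable section

open CategoryTheory AlgebraicGeometry TopologicalSpace IsLocalRing
open Literature.AlgebraicGeometry.Resolution

set_option linter.dupNamespace false

namespace Summit.ResolutionOfSingularities.ResolutionOfSingularities.Theorems.TeissierResolve.Negative

universe u

/-! ## Algebra I: the completion along an idempotent ideal is the quotient -/

/-- Let `I` be an IDEMPOTENT ideal (`I ⊆ I²`) of a ring `A` and `j : k → A` a ring map from a
field with `A = j(k) + I`. Then for every prime `P` of the `I`-adic completion `Â` (which is
`A ⧸ I`: all `Iⁿ = I`), the composite `k → A → Â → Â ⧸ P` is bijective. [folklore] -/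
theorem bijective_quotient_adicCompletion_of_idempotent {k A : Type*} [Field k] [CommRing A]
    (I : Ideal A) (hI : ∀ x ∈ I, x ∈ I ^ 2) (j : k →+* A)
    (hj : ∀ a : A, ∃ c : k, a - j c ∈ I)
    (P : Ideal (AdicCompletion I A)) [hP : P.IsPrime] :
    Function.Bijective ((Ideal.Quotient.mk P).comp
      ((algebraMap A (AdicCompletion I A)).comp j)) := by
  haveI : Nontrivial (AdicCompletion I A ⧸ P) := Ideal.Quotient.nontrivial_iff.mpr hP.ne_top
  have hpow : ∀ n, 1 ≤ n → I ^ n = I := by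
    intro n hn
    induction n, hn using Nat.le_induction with
    | base => exact pow_one I
    | succ n hn ih =>
      refine le_antisymm (Ideal.pow_le_self (by omega)) fun x hx => ?_
      rw [pow_succ, ih, ← pow_two]
      exact hI x hx
  have hmem : ∀ i ∈ I, ∀ n, i ∈ (I ^ n • ⊤ : Submodule A A) := by
    intro i hi n
    rcases Nat.eq_zero_or_pos n with rfl | hn
    · simp
    · rw [hpow n hn, smul_eq_mul, Ideal.mul_top]
      exact hi
  have hker : ∀ i ∈ I, algebraMap A (AdicCompletion I A) i = 0 := by
    intro i hi
    change AdicCompletion.of I A i = 0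
    ext n
    simp only [AdicCompletion.of_apply, Submodule.mkQ_apply, AdicCompletion.val_zero]
    exact (Submodule.Quotient.mk_eq_zero _).mpr (hmem i hi n)
  haveI : IsPrecomplete I A := ⟨fun f hf => ⟨f 1, fun n => by
    rcases Nat.eq_zero_or_pos n with rfl | hn
    · rw [pow_zero, Ideal.one_eq_top, Submodule.top_smul]
      exact SModEq.top
    · have h := hf hn
      rw [pow_one] at h
      rw [hpow n hn]
      exact h.symm⟩⟩
  have hsurj : Function.Surjective (algebraMap A (AdicCompletion I A)) :=
    AdicCompletion.of_surjective I A
  refine ⟨RingHom.injective _, fun y => ?_⟩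
  obtain ⟨z, rfl⟩ := Ideal.Quotient.mk_surjective y
  obtain ⟨a, rfl⟩ := hsurj z
  obtain ⟨c, hc⟩ := hj a
  refine ⟨c, ?_⟩
  change Ideal.Quotient.mk P (algebraMap A _ (j c)) = Ideal.Quotient.mk P (algebraMap A _ a)
  rw [Ideal.Quotient.eq, ← map_sub, hker _ (by simpa using I.neg_mem hc)]
  exact P.zero_mem

/-! ## Algebra II: squares and residues in a localisation -/

/-- If every element of `A` is a square, so is every element of a localisation of `A`
(`a/s = (b/s)²` with `b² = as`). [folklore] -/
theorem exists_sq_eq_of_isLocalization {A : Type*} [CommRing A] (M : Submonoid A) (L : Type*)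
    [CommRing L] [Algebra A L] [IsLocalization M L] (h : ∀ a : A, ∃ b : A, b ^ 2 = a)
    (y : L) : ∃ z : L, z ^ 2 = y := by
  obtain ⟨a, s, rfl⟩ := IsLocalization.exists_mk'_eq M y
  obtain ⟨b, hb⟩ := h (a * s)
  refine ⟨IsLocalization.mk' L b s, ?_⟩
  rw [pow_two, ← IsLocalization.mk'_mul, ← pow_two, hb]
  exact IsLocalization.mk'_cancel _ _ _

/-- In a local ring in which every element is a square, the maximal ideal is idempotent.
[folklore] -/
theorem mem_sq_maximalIdeal_of_forall_exists_sq {O : Type*} [CommRing O] [IsLocalRing O]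
    (h : ∀ a : O, ∃ b : O, b ^ 2 = a) (x : O) (hx : x ∈ maximalIdeal O) :
    x ∈ maximalIdeal O ^ 2 := by
  obtain ⟨b, rfl⟩ := h x
  have hb : b ∈ maximalIdeal O := by
    by_contra hb'
    have hu : IsUnit b := by simpa [mem_maximalIdeal, mem_nonunits_iff] using hb'
    exact (mem_maximalIdeal _).mp hx |> fun hn => hn (hu.pow 2)
  rw [pow_two, pow_two]
  exact Ideal.mul_mem_mul hb hb

/-! ## Algebra III: the closed points of `Spec k[X]⁺` have residue field `k` -/

section AbsoluteIntegralClosure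

open Polynomial
open Summit.ResolutionOfSingularities.ResolutionOfSingularities.Theorems.DescentAlgclosedToPerfect.Negative
  (absoluteIntegralClosure_exists_sq_eq not_hasResolution_spec_absoluteIntegralClosure)

/-- Over an algebraically closed field `k`, every maximal ideal `𝔪` of `k[X]⁺` (the integral
closure of `k[X]` in an algebraic closure of `k(X)`) has residue field `k`: `𝔪 ∩ k[X] = (X - c₀)`
and every element of `k[X]⁺`, being integral over `k[X]`, is modulo `𝔪` a root of a monic
polynomial with coefficients in `k = k[X]/(X - c₀)`, hence a constant. [folklore] -/
theorem absoluteIntegralClosure_exists_sub_mem (k : Type) [Field k] [IsAlgClosed k]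
    (m : Ideal ↥(integralClosure k[X] (AlgebraicClosure (RatFunc k)))) [hm : m.IsMaximal]
    (a : ↥(integralClosure k[X] (AlgebraicClosure (RatFunc k)))) :
    ∃ c : k, a - ((algebraMap k[X] ↥(integralClosure k[X] (AlgebraicClosure (RatFunc k)))).comp
      C) c ∈ m := by
  set ι := algebraMap k[X] ↥(integralClosure k[X] (AlgebraicClosure (RatFunc k))) with hι
  have hint : ι.IsIntegral := fun x => integralClosure.isIntegral x
  haveI hn : (m.comap ι).IsMaximal := Ideal.isMaximal_comap_of_isIntegral_of_isMaximal' ι hint m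
  -- `X - c₀ ∈ 𝔪 ∩ k[X]` for some `c₀`
  obtain ⟨c₀, hc₀⟩ : ∃ c₀ : k, (X - C c₀ : k[X]) ∈ m.comap ι := by
    set q := Submodule.IsPrincipal.generator (m.comap ι) with hq_def
    have hq : Ideal.span {q} = m.comap ι := Ideal.span_singleton_generator _
    have hq0 : q ≠ 0 := by
      intro h0
      have hbot : m.comap ι = ⊥ := by rw [← hq, h0, Ideal.span_singleton_eq_bot]
      have hX : Ideal.span {(X : k[X])} ≠ ⊤ := by
        rw [Ne, Ideal.span_singleton_eq_top]; exact Polynomial.not_isUnit_X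
      have h1 := hn.eq_of_le hX (by rw [hbot]; exact bot_le)
      rw [hbot] at h1
      exact Polynomial.X_ne_zero (Ideal.span_singleton_eq_bot.mp h1.symm)
    have hprime : Prime q := (Ideal.span_singleton_prime hq0).mp (hq ▸ hn.isPrime)
    have hdeg : q.degree = 1 := IsAlgClosed.degree_eq_one_of_irreducible k hprime.irreducible
    obtain ⟨c₀, hroot⟩ := IsAlgClosed.exists_root q (by rw [hdeg]; exact one_ne_zero)
    refine ⟨c₀, ?_⟩
    obtain ⟨r, hr⟩ := Polynomial.dvd_iff_isRoot.mpr hroot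
    rcases hprime.irreducible.isUnit_or_isUnit hr with hu | hu
    · exact absurd hu (Polynomial.not_isUnit_X_sub_C c₀)
    · rw [← hq, Ideal.mem_span_singleton]
      exact ⟨↑hu.unit⁻¹, by rw [hr, mul_assoc, IsUnit.mul_val_inv, mul_one]⟩
  haveI : IsDomain (↥(integralClosure k[X] (AlgebraicClosure (RatFunc k))) ⧸ m) :=
    Ideal.Quotient.isDomain m
  let θ : k →+* ↥(integralClosure k[X] (AlgebraicClosure (RatFunc k))) ⧸ m :=
    (Ideal.Quotient.mk m).comp (ι.comp C)
  have hθX : (Ideal.Quotient.mk m).comp ι = θ.comp (evalRingHom c₀) := by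
    apply Polynomial.ringHom_ext
    · intro c
      simp [θ]
    · simp only [RingHom.comp_apply, coe_evalRingHom, eval_X, θ]
      rw [Ideal.Quotient.eq, ← map_sub]
      exact hc₀
  have hθ : θ.IsIntegral := by
    intro y
    obtain ⟨b, rfl⟩ := Ideal.Quotient.mk_surjective y
    obtain ⟨f, hf, hfb⟩ := hint b
    refine ⟨f.map (evalRingHom c₀), hf.map _, ?_⟩
    rw [eval₂_map, ← hθX, ← hom_eval₂, hfb, map_zero]
  obtain ⟨c, hc⟩ := (IsAlgClosed.ringHom_bijective_of_isIntegral θ hθ).2 (Ideal.Quotient.mk m a)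
  refine ⟨c, ?_⟩
  rw [← Ideal.Quotient.eq]
  exact hc.symm

/-- In the localisation of `k[X]⁺` (`k` algebraically closed) at a maximal ideal, every element is
congruent to a constant modulo the maximal ideal. [folklore] -/
theorem absoluteIntegralClosure_localization_exists_sub_mem (k : Type) [Field k] [IsAlgClosed k]
    (m : Ideal ↥(integralClosure k[X] (AlgebraicClosure (RatFunc k)))) [hm : m.IsMaximal]
    (y : Localization.AtPrime m) :
    ∃ c : k, y - algebraMap _ (Localization.AtPrime m)
      (((algebraMap k[X] ↥(integralClosure k[X] (AlgebraicClosure (RatFunc k)))).comp C) c) ∈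
        maximalIdeal (Localization.AtPrime m) := by
  set j := (algebraMap k[X] ↥(integralClosure k[X] (AlgebraicClosure (RatFunc k)))).comp C
    with hj
  obtain ⟨a, s, rfl⟩ := IsLocalization.exists_mk'_eq m.primeCompl y
  obtain ⟨ca, hca⟩ := absoluteIntegralClosure_exists_sub_mem k m a
  obtain ⟨cs, hcs⟩ := absoluteIntegralClosure_exists_sub_mem k m (s : _)
  have hcs0 : cs ≠ 0 := by
    rintro rfl
    apply s.2
    simpa using hcs
  refine ⟨ca / cs, ?_⟩
  have hkey : (a : _) - j (ca / cs) * s ∈ m := by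
    have h1 : j (ca / cs) * j cs = j ca := by
      rw [← map_mul, div_mul_cancel₀ ca hcs0]
    have h2 : (a : _) - j (ca / cs) * s = (a - j ca) - j (ca / cs) * (s - j cs) := by
      rw [mul_sub, h1]; ring
    rw [h2]
    exact m.sub_mem hca (m.mul_mem_left _ hcs)
  have hunit : IsUnit (algebraMap ↥(integralClosure k[X] (AlgebraicClosure (RatFunc k)))
      (Localization.AtPrime m) (s : ↥(integralClosure k[X] (AlgebraicClosure (RatFunc k))))) :=
    IsLocalization.map_units (Localization.AtPrime m) s
  rw [← Ideal.mul_unit_mem_iff_mem _ hunit, sub_mul, IsLocalization.mk'_spec, ← map_mul,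
    ← map_sub]
  exact (IsLocalization.AtPrime.to_map_mem_maximal_iff (Localization.AtPrime m) m _).mpr hkey

/-! ## The witness: `Spec k[X]⁺ → Spec k` has Teissier branches at every closed point -/

set_option maxHeartbeats 400000 in
/-- Every conjunct of the predicate `TF` of `TeissierResolve` EXCEPT `IsFinite π` holds for
`X' = Spec k[X]⁺ → S = Spec k` (`k` algebraically closed; `k[X]⁺` the integral closure of `k[X]`
in an algebraic closure of `k(X)`, an integral, non-Noetherian, one-dimensional domain, NOT of
finite type over `k`): at every closed point `x` the local ring `𝒪 = (k[X]⁺)_𝔪` is square-root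
closed, so its maximal ideal is idempotent and the `𝔪`-adic completion is `𝒪/𝔪 = k`
(`absoluteIntegralClosure_exists_sub_mem`); its unique (minimal) prime is `0` and the branch
`k = k⟦∅⟧` is Teissier-presented with `d = g = 0`, compatibly with `𝒪̂_{Spec k} = k`.
[folklore] -/
theorem specAbsoluteIntegralClosure_teissierBranches (k : Type) [Field k] [IsAlgClosed k] :
    ∃ (S : Scheme.{0}) (g : S ⟶ Spec (.of k))
      (π : Spec (.of ↥(integralClosure k[X] (AlgebraicClosure (RatFunc k)))) ⟶ S),
      IsSeparated g ∧ LocallyOfFiniteType g ∧ QuasiCompact g ∧ IsIntegral S ∧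
      Scheme.IsRegular S ∧
      IsIntegral (Spec (.of ↥(integralClosure k[X] (AlgebraicClosure (RatFunc k))))) ∧
      ∀ x : ↥(Spec (.of ↥(integralClosure k[X] (AlgebraicClosure (RatFunc k))))),
        IsClosed ({x} : Set ↥(Spec (.of ↥(integralClosure k[X] (AlgebraicClosure (RatFunc k)))))) →
        ∀ P ∈ minimalPrimes (AdicCompletion
            (maximalIdeal ((Spec (.of ↥(integralClosure k[X]
              (AlgebraicClosure (RatFunc k))))).presheaf.stalk x))
            ((Spec (.of ↥(integralClosure k[X] (AlgebraicClosure (RatFunc k))))).presheaf.stalk x)),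
          ∃ (d : ℕ)
            (φ : AdicCompletion (maximalIdeal (S.presheaf.stalk (π.base x)))
                (S.presheaf.stalk (π.base x)) ≃+* MvPowerSeries (Fin d) k)
            (ι : MvPowerSeries (Fin d) k →+*
              AdicCompletion (maximalIdeal ((Spec (.of ↥(integralClosure k[X]
                (AlgebraicClosure (RatFunc k))))).presheaf.stalk x))
                ((Spec (.of ↥(integralClosure k[X]
                  (AlgebraicClosure (RatFunc k))))).presheaf.stalk x) ⧸ P),
            TeissierPresentation k d _ ι ∧
              ∀ a : S.presheaf.stalk (π.base x),
                ι (φ (algebraMap _ _ a)) =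
                  Ideal.Quotient.mk P (algebraMap _ _ ((π.stalkMap x).hom a)) := by
  classical
  let A : Type := ↥(integralClosure k[X] (AlgebraicClosure (RatFunc k)))
  let j : k →+* A := (algebraMap k[X] A).comp C
  let f : CommRingCat.of k ⟶ CommRingCat.of A := CommRingCat.ofHom j
  refine ⟨Spec (.of k), 𝟙 _, Spec.map f, inferInstance, inferInstance, inferInstance,
    inferInstance, Scheme.isRegular_Spec _, inferInstance, ?_⟩
  intro x hx P hP
  haveI : P.IsPrime := hP.1.1
  haveI hxmax : x.asIdeal.IsMaximal := (PrimeSpectrum.isClosed_singleton_iff_isMaximal x).mp hx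
  -- the base side (verbatim as for the fat point)
  let q : PrimeSpectrum k := (Spec.map f).base x
  let jS : k →+* (Spec (.of k)).presheaf.stalk q :=
    (Spec.stalkIso (.of k) q).inv.hom.comp (algebraMap k (Localization.AtPrime q.asIdeal))
  have hjS : Function.Bijective jS := by
    refine (Spec.stalkIso (.of k) q).commRingCatIsoToRingEquiv.symm.bijective.comp ?_
    exact Field.localization_map_bijective (M := q.asIdeal.primeCompl)
      (fun h => h (Ideal.zero_mem _))
  haveI : IsArtinianRing ((Spec (.of k)).presheaf.stalk q) := hjS.surjective.isArtinianRing
  let eS := AdicCompletion.ofAlgEquiv (maximalIdeal ((Spec (.of k)).presheaf.stalk q))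
    (S := (Spec (.of k)).presheaf.stalk q)
  let e3 : k ≃+* MvPowerSeries (Fin 0) k :=
    RingEquiv.ofBijective _ (bijective_C_mvPowerSeries_fin_zero k)
  let φ : AdicCompletion (maximalIdeal ((Spec (.of k)).presheaf.stalk q))
      ((Spec (.of k)).presheaf.stalk q) ≃+* MvPowerSeries (Fin 0) k :=
    eS.symm.toRingEquiv.trans ((RingEquiv.ofBijective jS hjS).symm.trans e3)
  -- the `k[X]⁺` side
  let L := Localization.AtPrime x.asIdeal
  let e : (Spec (.of A)).presheaf.stalk x ≃+* L := (Spec.stalkIso (.of A) x).commRingCatIsoToRingEquiv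
  let jX : A →+* (Spec (.of A)).presheaf.stalk x :=
    (Spec.stalkIso (.of A) x).inv.hom.comp (algebraMap A L)
  have hsqL : ∀ y : L, ∃ z : L, z ^ 2 = y :=
    exists_sq_eq_of_isLocalization x.asIdeal.primeCompl L (absoluteIntegralClosure_exists_sq_eq k)
  have hsqO : ∀ o : (Spec (.of A)).presheaf.stalk x, ∃ z, z ^ 2 = o := fun o => by
    obtain ⟨z, hz⟩ := hsqL (e o)
    exact ⟨e.symm z, by rw [← map_pow, hz, e.symm_apply_apply]⟩
  have hI : ∀ o ∈ maximalIdeal ((Spec (.of A)).presheaf.stalk x),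
      o ∈ maximalIdeal ((Spec (.of A)).presheaf.stalk x) ^ 2 :=
    mem_sq_maximalIdeal_of_forall_exists_sq hsqO
  have hj : ∀ o : (Spec (.of A)).presheaf.stalk x, ∃ c : k,
      o - (jX.comp j) c ∈ maximalIdeal ((Spec (.of A)).presheaf.stalk x) := by
    intro o
    obtain ⟨c, hc⟩ := absoluteIntegralClosure_localization_exists_sub_mem k x.asIdeal (e o)
    refine ⟨c, ?_⟩
    have he : o - (jX.comp j) c = e.symm (e o - algebraMap A L (j c)) := by
      rw [map_sub, e.symm_apply_apply]
      rfl
    rw [he]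
    haveI := isLocalHom_equiv e.symm
    exact (map_mem_nonunits_iff e.symm _).mpr hc
  have hθ := bijective_quotient_adicCompletion_of_idempotent
    (maximalIdeal ((Spec (.of A)).presheaf.stalk x)) hI (jX.comp j) hj P
  let eX := RingEquiv.ofBijective _ hθ
  refine ⟨0, φ, eX.toRingHom.comp e3.symm.toRingHom, ?_, fun a => ?_⟩
  · have := (TeissierPresentation.mvPowerSeries k 0).of_ringEquiv (e3.symm.trans eX)
    simpa using this
  · obtain ⟨c, rfl⟩ := hjS.surjective a
    have hnat : ((Spec.map f).stalkMap x).hom (jS c) = jX (j c) :=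
      stalkMap_stalkIso_inv_algebraMap f x c
    rw [hnat]
    have h1 : eS.symm (algebraMap _ (AdicCompletion (maximalIdeal ((Spec (.of k)).presheaf.stalk q))
        ((Spec (.of k)).presheaf.stalk q)) (jS c)) = jS c := by
      exact eS.symm_apply_apply (jS c)
    have h2 : (RingEquiv.ofBijective jS hjS).symm (jS c) = c :=
      (RingEquiv.ofBijective jS hjS).symm_apply_apply c
    simp only [RingHom.comp_apply, RingEquiv.toRingHom_eq_coe, RingHom.coe_coe, φ,
      RingEquiv.trans_apply, AlgEquiv.coe_ringEquiv]
    rw [h1, h2, RingEquiv.symm_apply_apply]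
    rfl

/-! ## Finiteness of `π` is load-bearing -/

/-- **`TeissierResolve` is false without `IsFinite π`**, at every prime `p`: drop the conjunct
`IsFinite π` from the predicate `TF` (all other conjuncts verbatim, `teissierPresented_iff`) and
the conclusion `Scheme.HasResolution X'` fails for `X' = Spec 𝔽̄_p[X]⁺ → S = Spec 𝔽̄_p`
(`specAbsoluteIntegralClosure_teissierBranches`; no resolution:
`Theorems.DescentAlgclosedToPerfect.Negative.not_hasResolution_spec_absoluteIntegralClosure` —
every non-generic stalk of the square-root closed domain `k[X]⁺` is non-Noetherian). MORAL for
provers: the ONLY Noetherianity (indeed the only finiteness) in `TF` enters through `IsFinite π`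
and the finite type of `S`; the completion-based branch condition does not see it, since the
`𝔪`-adic completion of a local ring with idempotent maximal ideal is its residue field. Any proof
must use that `𝒪_{X',x}` is Noetherian — e.g. through `𝒪_{X',x} ↪ 𝒪̂_{X',x}` (Krull's
intersection theorem), which fails here. [folklore] -/
theorem teissierResolve_false_without_isFinite (p : ℕ) [Fact p.Prime] :
    ¬ ∀ (k : Type) [Field k] [CharP k p] [IsAlgClosed k] (X' : Scheme.{0}),
      (∃ (S : Scheme.{0}) (g : S ⟶ Spec (.of k)) (π : X' ⟶ S),
        IsSeparated g ∧ LocallyOfFiniteType g ∧ QuasiCompact g ∧ IsIntegral S ∧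
        Scheme.IsRegular S ∧ IsIntegral X' ∧
        ∀ x : X', IsClosed ({x} : Set X') →
          ∀ P ∈ minimalPrimes
              (AdicCompletion (maximalIdeal (X'.presheaf.stalk x)) (X'.presheaf.stalk x)),
            ∃ (d : ℕ)
              (φ : AdicCompletion (maximalIdeal (S.presheaf.stalk (π.base x)))
                  (S.presheaf.stalk (π.base x)) ≃+* MvPowerSeries (Fin d) k)
              (ι : MvPowerSeries (Fin d) k →+*
                AdicCompletion (maximalIdeal (X'.presheaf.stalk x)) (X'.presheaf.stalk x) ⧸ P),
              TeissierPresentation k d _ ι ∧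
                ∀ a : S.presheaf.stalk (π.base x),
                  ι (φ (algebraMap _ _ a)) =
                    Ideal.Quotient.mk P (algebraMap _ _ ((π.stalkMap x).hom a))) →
      Scheme.HasResolution X' := by
  intro h
  let K : Type := AlgebraicClosure (ZMod p)
  exact not_hasResolution_spec_absoluteIntegralClosure K
    (h K (Spec (.of ↥(integralClosure K[X] (AlgebraicClosure (RatFunc K)))))
      (specAbsoluteIntegralClosure_teissierBranches K))

end AbsoluteIntegralClosure

end Summit.ResolutionOfSingularities.ResolutionOfSingularities.Theorems.TeissierResolve.Negative

end
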